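import Summits.Ventures.YMGap.Conjectures.StrongCouplingChiralLRO
import Literature.MathematicalPhysics.QuantumLattice.StaggeredMasslessDeterminant
import HarnessLib
import HarnessLib.Audit.Tags

/-!
# Venture YMGap — Conjectures/StrongCouplingChiralLROEveryCoupling.lean: structural facts about the
# objects of the typed conjecture `SalmhoferSeilerSmallBeta` at EVERY coupling `β`

HONEST FRAMING (venture `Summits/Ventures/YMGap`, cell `pub-ymgap`, seat qcd-lit g17, `bears_on: Q1`).  The
conjecture `Summit.Ventures.YMGap.Conjectures.SalmhoferSeilerSmallBeta` (`Conjectures/StrongCouplingChiralLRO.lean`)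
is NOT proved here and remains open (`β > 0`: not in print).  Its `β = 0` member is the theorem
`salmhoferSeiler_betaZero` (`Conjectures/StrongCouplingChiralLROZeroCoupling.lean`).  This file turns three
further sentences of the conjecture's docstring into theorems about its OWN objects (`ssPartitionFunction`,
`ssTwoPoint`, `ssChiralOrder` at `m = 0`), valid at EVERY real `β` — they restrict nothing about `β > 0`
except what the massless staggered determinant forces for every gauge field:

* **`ssPartitionFunction_massless_pos`** — «`Z_Λ(β, 0) > 0` for every `β` and the normalised expectation is
  a genuine quotient»: `0 < ssPartitionFunction N ν L β 0` for every real `β`, even `L`, `ν ≥ 1` (from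
  `StrongCoupling.integral_det_D0_re_wilsonWeight_pos`: `det D₀[U] ≥ 0` for all `U`, `> 0` off a Haar-null
  set, positive Wilson density);
* **`ssTwoPoint_massless_eq_zero_of_sgn_eq`** — «by chiral symmetry ((2.7), all `β`) only odd sites
  `ε(x) = -1` contribute to the sum at `m = 0` ((3.101))»: `ssTwoPoint N ν L β 0 x y = 0` whenever
  `ε(x) = ε(y)` (`ε = ComplexSpin.sgn`, Salmhofer–Seiler (2.8)), for every real `β` (from
  `StrongCoupling.wick2_inv_D0_eq_zero_of_sgn_eq`: the Wick contraction with the propagator `D₀[U]⁻¹`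
  vanishes for EVERY gauge field — fixed-gauge-field chiral grading (3.101)/(3.106), junk `D₀⁻¹ = 0` on the
  singular set);
* **`ssChiralOrder_eq_sum_odd`** — consequently `ssChiralOrder N ν L β = |Λ_L|⁻¹ ∑_{ε(x) = -1} ssTwoPoint N ν L β 0 0 x`
  at every `β`.

WHAT THIS IS NOT: no statement about the SIZE of the odd-site sum at `β > 0` (that is the conjecture); nothing
about `SU(N)`, Wilson fermions, the continuum, `IsChiralAtZero`, a mass gap, or the Clay problem.  Theorems
only; no facts, no `sorry`.

Reference: M. Salmhofer, E. Seiler, Commun. Math. Phys. 139 (1991) 395–432, §2 (2.7)–(2.12), §3 (3.101)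
[SalmhoferSeiler1991].
-/

noncomputable section

namespace Summit.Ventures.YMGap.Conjectures

open MeasureTheory Finset
open Literature.MathematicalPhysics.QuantumLattice
open Literature.MathematicalPhysics.StatisticalMechanics (ComplexSpin.sgn ComplexSpin.sgn_zero)
open Literature.Probability.LatticeModels (TorusSite)

/-- **`Z_Λ(β, 0) > 0` at every coupling**: the massless staggered partition function of the conjecture,
`ssPartitionFunction N ν L β 0 = ∫ Re det D₀[U] d(wilsonWeight ρ β)`, is positive for every real `β`
(even `L`, `ν ≥ 1`). [cite: SalmhoferSeiler1991, §2 (2.9)–(2.12)] -/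
theorem ssPartitionFunction_massless_pos (N ν L : ℕ) [NeZero L] (hν : 1 ≤ ν) (hL : Even L) (β : ℝ) :
    0 < ssPartitionFunction N ν L β 0 := by
  haveI : NeZero ν := ⟨by omega⟩
  exact StrongCoupling.integral_det_D0_re_wilsonWeight_pos (N := N) hL β

/-- **The `m = 0` selection rule at every coupling**: the conjecture's two-point function
`ssTwoPoint N ν L β 0 x y` vanishes whenever `ε(x) = ε(y)` (Salmhofer–Seiler's staggered sign (2.8)), for
every real `β` — only sites of parity opposite to the source contribute at zero mass ((3.101)). [cite: SalmhoferSeiler1991, §3 (3.101)] -/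
theorem ssTwoPoint_massless_eq_zero_of_sgn_eq (N ν L : ℕ) [NeZero L] (hν : 1 ≤ ν) (hL : 2 ∣ L) (β : ℝ)
    {x y : TorusSite ν L} (hxy : ComplexSpin.sgn hL x = ComplexSpin.sgn hL y) :
    ssTwoPoint N ν L β 0 x y = 0 := by
  haveI : NeZero ν := ⟨by omega⟩
  unfold ssTwoPoint
  rw [div_eq_zero_iff]
  left
  exact StrongCoupling.integral_det_re_mul_wick_re_eq_zero_of_sgn_eq (N := N) hL _ hxy

/-- **Only the odd sites contribute to the chiral order parameter at `m = 0`, at every coupling**: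
`ssChiralOrder N ν L β = |Λ_L|⁻¹ ∑_{x : ε(x) = -1} ssTwoPoint N ν L β 0 0 x`. [cite: SalmhoferSeiler1991, §3 (3.101) with (4.43)] -/
theorem ssChiralOrder_eq_sum_odd (N ν L : ℕ) [NeZero L] (hν : 1 ≤ ν) (hL : 2 ∣ L) (β : ℝ) :
    ssChiralOrder N ν L β =
      ((L : ℝ) ^ ν)⁻¹ * ∑ x ∈ Finset.univ.filter (fun x : TorusSite ν L => ComplexSpin.sgn hL x = -1),
        ssTwoPoint N ν L β 0 0 x := by
  unfold ssChiralOrder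
  congr 1
  rw [← Finset.sum_filter_add_sum_filter_not Finset.univ (fun x : TorusSite ν L => ComplexSpin.sgn hL x = -1),
    add_eq_left]
  refine Finset.sum_eq_zero fun x hx => ?_
  rw [Finset.mem_filter] at hx
  refine ssTwoPoint_massless_eq_zero_of_sgn_eq N ν L hν hL β ?_
  -- `ε(0) = 1 = ε(x)` for an `x` with `ε(x) ≠ -1`
  rw [ComplexSpin.sgn_zero]
  unfold ComplexSpin.sgn at hx ⊢
  split_ifs with h
  · rfl
  · exact absurd (by simp [h]) hx.2

end Summit.Ventures.YMGap.Conjectures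

end
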